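import Literature.Barriers.Parity.SiegelZeroPrimePairsCnTau
import Literature.Barriers.Parity.SiegelZeroPrimePairsInitialSteps
import Literature.Barriers.Parity.SiegelZeroPrimePairsParameters
import HarnessLib

/-!
# Matomäki–Merikoski (7.1), weak form: the error of (2.6) + Lemma 2.1 + Lemma 2.2 in the currency of §7

Sibling of `SiegelZeroPrimePairsInitialSteps.lean` ((2.6) of the IMRN numbering, `MatomakiMerikoski2023_eq26`),
`SiegelZeroPrimePairsCnHalf.lean` (the `c_n`-half of the error of (2.6) under the exceptional zero) and
`SiegelZeroPrimePairsCnTau.lean` (the `τ(n) c_{n+h}`-half, by structure + pair sieve, losing `2^u`).  Everything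
here is PROVED (theorems only).  In §7 of Matomäki–Merikoski (IMRN 2023; arXiv:2112.11412, p. 20, first display
(7.1)) one reads, with `z = X^{1/u}`, `u = min{√(V log η)/(10C), log η}` ((7.2)), `V = log X/log q`,

  `∑_n g(n/X)Λ(n)Λ(n+h) = ∑_{(n(n+h), qP(z)) = 1} g(n/X) λ'(n)λ'(n+h) + O((h/φ(h)) X (u⁸/(V²η^{V/(3u)}) + u⁶V/η + …))`,

every error being afterwards shown to be `≪ exp(−C√(V log η)) + V log⁶η/η`.  This file proves the corresponding
statement with the tree's substitutes for Lemma 2.1, in the final currency directly: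

* `MatomakiMerikoski.eq71_params` — the parameter facts for `u = min{√(Vℓ)/(10C), ℓ}`, `ℓ = log η ≥ 44C²`,
  `log η ≤ (log q)/100`, `X ≥ q^{37/4}`, `V η^{−1/4} ≤ 1`: `2 ≤ u ≤ ℓ`, `log z = (log X)/u ≥ 10⁴C²u`,
  `e^{−10C²u} ≤ T'`, `1/(v²η^{v/2}) ≤ (1+u²)e^{−50C²u}` (`v = V/u`), `V ≤ η^{1/4}` (**proved**);
* `MatomakiMerikoski.MatomakiMerikoski2023_eq71_weak` — for `C ≥ 1` there are `η₀, K` such that for every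
  primitive quadratic `χ (mod q)`, `q ≥ 3`, `η ≥ η₀`, `log η ≤ (log q)/100`, `L(1 − 1/(η log q), χ) = 0`, every
  `X ≥ q^{37/4}` with `V η^{−1/4} ≤ 1`, every weight `0 ≤ g ≤ 1` supported in `[1, 2]` and every `1 ≤ h ≤ X`:
  `|∑_{n ≤ 2X} g(n/X)Λ(n)Λ(n+h) − ∑_{n ≤ 2X adm} g(n/X)λ'(n)λ'(n+h)| ≤ K (h/φ(h)) X (exp(−C√(Vℓ)) + V η^{−1/4})`,
  where "adm" = every prime factor of `n` and of `n + h` is `≥ z = q^{V/u}` (`= X^{1/u}`) and prime to `q`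
  (**proved**: `MatomakiMerikoski2023_eq26` + `…CnHalf…_of_exceptionalZero` + `…CnTau…_of_exceptionalZero`
  + the bookkeeping lemmas `eq71_E0_le`, `eq71_E1_le`, `eq71_E2a_le`, `eq71_E2b_le`).

The third rate is `V η^{−1/4}` instead of the printed `V log⁶η/η` (the `2^u` of the `τ`-half; see the
discussion in `SiegelZeroPrimePairsCnTau.lean` and `SiegelZeroPrimePairsWeakThirdRate.lean`, by which Corollary
1.1(i) is unaffected), and the shift is restricted to `h ≤ X` (the structural bound of the `τ`-half is `∝ N + h`).

## References

* K. Matomäki, J. Merikoski, IMRN 2023:23, 20337–20384 (arXiv:2112.11412), §7 (7.1)–(7.2), Lemmas 2.1–2.2,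
  (2.5)–(2.6). [cite: MatomakiMerikoski2023, §7 (7.1)]
-/

noncomputable section

open Finset Real
open scoped ArithmeticFunction.vonMangoldt

namespace Literature.Barriers.Parity.MatomakiMerikoski

open Literature.Barriers.Parity.TaoTeravainen
open Literature.NumberTheory.LFunctions

/-! ### The parameters (7.2) -/

/-- The two regimes of `u = min{s/(10C), ℓ}`: in either case `100 C² u² ≤ s²` once `s ≥ 20C`, `ℓ ≥ 2`;
also `2 ≤ u ≤ ℓ`. [cite: MatomakiMerikoski2023, §7 (7.2)] -/
theorem eq71_min_facts {C s ℓ u : ℝ} (hC : 0 < C) (hs20 : 20 * C ≤ s) (hℓ2 : 2 ≤ ℓ)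
    (hu : u = min (s / (10 * C)) ℓ) :
    2 ≤ u ∧ u ≤ ℓ ∧ 100 * C ^ 2 * u ^ 2 ≤ s ^ 2 ∧
    ((u = s / (10 * C) ∧ s = 10 * C * u) ∨ (u = ℓ ∧ 10 * C * ℓ ≤ s)) := by
  have h10 : 0 < 10 * C := by positivity
  have hu2 : 2 ≤ u := by
    rw [hu]; refine le_min ?_ hℓ2
    rw [le_div_iff₀ h10]; linarith
  have huℓ : u ≤ ℓ := by rw [hu]; exact min_le_right _ _
  have hcases : (u = s / (10 * C) ∧ s = 10 * C * u) ∨ (u = ℓ ∧ 10 * C * ℓ ≤ s) := by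
    rcases le_or_gt (s / (10 * C)) ℓ with h1 | h1
    · refine Or.inl ⟨by rw [hu, min_eq_left h1], ?_⟩
      rw [hu, min_eq_left h1]; field_simp
    · refine Or.inr ⟨by rw [hu, min_eq_right h1.le], ?_⟩
      rw [lt_div_iff₀ h10] at h1; linarith
  refine ⟨hu2, huℓ, ?_, hcases⟩
  rcases hcases with ⟨-, hsu⟩ | ⟨huℓ', hle⟩
  · rw [hsu]; ring_nf; exact le_rfl
  · rw [huℓ']
    have h0 : 0 ≤ 10 * C * ℓ := by positivity
    nlinarith

set_option maxHeartbeats 800000 in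
/-- **The parameter facts behind (7.1)–(7.2), weak currency.**  Let `C ≥ 1`, `q ≥ 3`, `η ≥ 10` with
`ℓ = log η ≥ 44C²` and `log η ≤ (log q)/100`, `X ≥ q^{37/4}`, `V = log X/log q`, `u = min{√(Vℓ)/(10C), ℓ}` and
`V η^{−1/4} ≤ 1`.  Then `2 ≤ u ≤ ℓ`, `37/4 ≤ V ≤ η^{1/4}`, `log X = V log q`, `(log X)/u ≥ 10⁴C²u`,
`e^{−10C²u} ≤ exp(−C√(Vℓ)) + Vη^{−1/4}` and `1/((V/u)² η^{V/(2u)}) ≤ (1 + u²) e^{−50C²u}`.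
[cite: MatomakiMerikoski2023, §7 (7.2)] -/
theorem eq71_params {C : ℝ} (hC : 1 ≤ C) {q : ℕ} (hq : 3 ≤ q) {η X V ℓ u : ℝ} (hη : 10 ≤ η)
    (hℓ44 : 44 * C ^ 2 ≤ ℓ) (hηq : Real.log η ≤ Real.log q / 100) (hX : (q : ℝ) ^ (37 / 4 : ℝ) ≤ X)
    (hV : V = Real.log X / Real.log q) (hℓ : ℓ = Real.log η)
    (hu : u = min (Real.sqrt (V * ℓ) / (10 * C)) ℓ) (hnorm : V * η ^ (-(1 / 4 : ℝ)) ≤ 1) :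
    2 ≤ u ∧ u ≤ ℓ ∧ 37 / 4 ≤ V ∧ V ≤ η ^ (1 / 4 : ℝ) ∧ 0 < Real.log q ∧ Real.log X = V * Real.log q ∧
    10 ^ 4 * C ^ 2 * u ≤ Real.log X / u ∧
    Real.exp (-(10 * C ^ 2 * u)) ≤ Real.exp (-(C * Real.sqrt (V * ℓ))) + V * η ^ (-(1 / 4 : ℝ)) ∧
    1 / ((V / u) ^ 2 * η ^ (V / u / 2)) ≤ (1 + u ^ 2) * Real.exp (-(50 * C ^ 2 * u)) := by
  have hC0 : 0 < C := by linarith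
  have hC2 : 1 ≤ C ^ 2 := one_le_pow₀ hC
  have hq3 : (3 : ℝ) ≤ q := by exact_mod_cast hq
  have hq0 : (0 : ℝ) < q := by linarith
  have hlogq : 0 < Real.log q := Real.log_pos (by linarith)
  have hη0 : 0 < η := by linarith
  have hℓ2 : 2 ≤ ℓ := le_trans (by nlinarith) hℓ44
  have hℓ0 : 0 < ℓ := by linarith
  have hlq : 100 * ℓ ≤ Real.log q := by rw [hℓ]; linarith
  -- `X`, `V`
  have hqpow : 0 < (q : ℝ) ^ (37 / 4 : ℝ) := Real.rpow_pos_of_pos hq0 _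
  have hX0 : 0 < X := lt_of_lt_of_le hqpow hX
  have hlogX : 37 / 4 * Real.log q ≤ Real.log X := by
    have := Real.log_le_log hqpow hX
    rwa [Real.log_rpow hq0] at this
  have hV9 : 37 / 4 ≤ V := by rw [hV, le_div_iff₀ hlogq]; exact hlogX
  have hV0 : 0 < V := by linarith
  have hV1 : 1 ≤ V := by linarith
  have hlogXeq : Real.log X = V * Real.log q := by rw [hV]; field_simp
  -- `V ≤ η^{1/4}`
  have hpow4 : η ^ (-(1 / 4 : ℝ)) * η ^ (1 / 4 : ℝ) = 1 := by
    rw [← Real.rpow_add hη0]; norm_num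
  have hη4 : 0 < η ^ (1 / 4 : ℝ) := Real.rpow_pos_of_pos hη0 _
  have hVη : V ≤ η ^ (1 / 4 : ℝ) := by
    have := mul_le_mul_of_nonneg_right hnorm hη4.le
    rwa [mul_assoc, hpow4, mul_one, one_mul] at this
  -- `s = √(Vℓ)` and the two regimes
  obtain ⟨s, hs⟩ : ∃ s : ℝ, s = Real.sqrt (V * ℓ) := ⟨_, rfl⟩
  have hVℓ : 0 ≤ V * ℓ := by positivity
  have hs2 : s ^ 2 = V * ℓ := by rw [hs]; exact Real.sq_sqrt hVℓ
  have hs0 : 0 ≤ s := by rw [hs]; exact Real.sqrt_nonneg _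
  have hs400 : 400 * C ^ 2 ≤ s ^ 2 := by rw [hs2]; nlinarith
  have hs20 : 20 * C ≤ s := by nlinarith
  rw [← hs] at hu ⊢
  obtain ⟨hu2, huℓ, hkey, hcases⟩ := eq71_min_facts hC0 hs20 hℓ2 hu
  have hu0 : 0 < u := by linarith
  refine ⟨hu2, huℓ, hV9, hVη, hlogq, hlogXeq, ?_, ?_, ?_⟩
  · -- `10⁴ C² u ≤ log X / u`, i.e. `10⁴ C² u² ≤ log X`; `log X = V log q ≥ 100 V ℓ = 100 s²`
    rw [le_div_iff₀ hu0]
    have h1 : 100 * (V * ℓ) ≤ Real.log X := by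
      rw [hlogXeq]
      have := mul_le_mul_of_nonneg_left hlq hV0.le
      linarith
    rw [← hs2] at h1
    nlinarith [hkey, h1]
  · -- `e^{−10C²u} ≤ T'`
    have hT0 : 0 ≤ V * η ^ (-(1 / 4 : ℝ)) := by positivity
    rcases hcases with ⟨-, hsu⟩ | ⟨hB, -⟩
    · have : 10 * C ^ 2 * u = C * s := by rw [hsu]; ring
      rw [this]
      linarith
    · -- `u = ℓ`: `e^{−10C²ℓ} ≤ e^{−ℓ/4} = η^{−1/4} ≤ V η^{−1/4}`
      have hℓC : ℓ * (1 / 4) ≤ 10 * C ^ 2 * ℓ := by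
        have := mul_le_mul_of_nonneg_right hC2 hℓ0.le
        linarith
      have h1 : Real.exp (-(10 * C ^ 2 * u)) ≤ η ^ (-(1 / 4 : ℝ)) := by
        rw [Real.rpow_def_of_pos hη0, ← hℓ, hB, Real.exp_le_exp]
        linarith
      have h2 : η ^ (-(1 / 4 : ℝ)) ≤ V * η ^ (-(1 / 4 : ℝ)) := by
        have h3 : 0 ≤ η ^ (-(1 / 4 : ℝ)) := Real.rpow_nonneg hη0.le _
        nlinarith
      linarith [Real.exp_pos (-(C * s))]
  · -- `1/((V/u)² η^{V/(2u)}) = (u/V)² e^{−Vℓ/(2u)} ≤ (1+u²) e^{−50C²u}`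
    have hpow : η ^ (V / u / 2) = Real.exp (V * ℓ / (2 * u)) := by
      rw [Real.rpow_def_of_pos hη0, ← hℓ]; congr 1; field_simp
    have hvu : (V / u) ^ 2 = V ^ 2 / u ^ 2 := by rw [div_pow]
    have hV2 : 0 < V ^ 2 := by positivity
    have hu2' : 0 < u ^ 2 := by positivity
    have hrew : 1 / ((V / u) ^ 2 * η ^ (V / u / 2)) = (u ^ 2 / V ^ 2) * Real.exp (-(V * ℓ / (2 * u))) := by
      rw [hpow, hvu, Real.exp_neg]
      field_simp
    rw [hrew]
    have h1 : u ^ 2 / V ^ 2 ≤ 1 + u ^ 2 := by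
      have : u ^ 2 / V ^ 2 ≤ u ^ 2 := div_le_self hu2'.le (one_le_pow₀ hV1)
      linarith
    have h2 : Real.exp (-(V * ℓ / (2 * u))) ≤ Real.exp (-(50 * C ^ 2 * u)) := by
      rw [Real.exp_le_exp, neg_le_neg_iff, le_div_iff₀ (by positivity)]
      rw [← hs2]
      have e : 50 * C ^ 2 * u * (2 * u) = 100 * C ^ 2 * u ^ 2 := by ring
      linarith [hkey, e]
    exact mul_le_mul h1 h2 (Real.exp_pos _).le (by positivity)

/-- `ℓ² e^{−ℓ/20} ≤ 800`, `ℓ² e^{−3ℓ/4} ≤ 4` (`ℓ ≥ 0`). [folklore] -/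
theorem sq_mul_exp_bounds {ℓ : ℝ} (hℓ : 0 ≤ ℓ) :
    ℓ ^ 2 * Real.exp (-(ℓ / 20)) ≤ 800 ∧ ℓ ^ 2 * Real.exp (-(3 * ℓ / 4)) ≤ 4 := by
  constructor
  · have h := pow_mul_exp_neg_mul_le 2 (show (0 : ℝ) < 1 / 20 by norm_num) hℓ
    rw [show (1 : ℝ) / 20 * ℓ = ℓ / 20 by ring] at h
    refine h.trans ?_
    norm_num [Nat.factorial]
  · have h := pow_mul_exp_neg_mul_le 2 (show (0 : ℝ) < 3 / 4 by norm_num) hℓ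
    rw [show (3 : ℝ) / 4 * ℓ = 3 * ℓ / 4 by ring] at h
    refine h.trans ?_
    norm_num [Nat.factorial]

/-- `2^t ≤ e^{7t/10}` and `4^t ≤ e^{7t/5}` for `t ≥ 0` (real powers). [folklore] -/
theorem two_rpow_le_exp {t : ℝ} (ht : 0 ≤ t) :
    (2 : ℝ) ^ t ≤ Real.exp ((7 / 10 : ℝ) * t) ∧ (4 : ℝ) ^ t ≤ Real.exp ((7 / 5 : ℝ) * t) := by
  have hl2 := Real.log_two_lt_d9
  have hl4 : Real.log 4 = 2 * Real.log 2 := by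
    rw [show (4 : ℝ) = 2 ^ 2 by norm_num, Real.log_pow]; ring
  constructor
  · rw [Real.rpow_def_of_pos two_pos, Real.exp_le_exp]; nlinarith
  · rw [Real.rpow_def_of_pos (by norm_num : (0 : ℝ) < 4), Real.exp_le_exp, hl4]; nlinarith

/-! ### Bookkeeping: each error term is `≪ X T'` -/

/-- `Lz² e^{−Lz} ≤ 8 e^{−Lz/2}` and `(u Lz)³ ≤ 48 e^{uLz/2}` (`Lz, u Lz ≥ 0`). [folklore] -/
theorem Lz_aux {Lz w : ℝ} (hLz : 0 ≤ Lz) (hw : 0 ≤ w) :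
    Lz ^ 2 * Real.exp (-Lz) ≤ 8 * Real.exp (-(Lz / 2)) ∧ w ^ 3 ≤ 48 * Real.exp (w / 2) := by
  constructor
  · have h := pow_mul_exp_neg_mul_le 2 (show (0 : ℝ) < 1 / 2 by norm_num) hLz
    have e : Real.exp (-Lz) = Real.exp (-(1 / 2 * Lz)) * Real.exp (-(Lz / 2)) := by
      rw [← Real.exp_add]; ring_nf
    rw [e, ← mul_assoc]
    refine mul_le_mul_of_nonneg_right (h.trans ?_) (Real.exp_pos _).le
    norm_num [Nat.factorial]
  · have h := pow_mul_exp_neg_mul_le 3 (show (0 : ℝ) < 1 / 2 by norm_num) hw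
    have h48 : ((3 : ℕ).factorial : ℝ) / (1 / 2) ^ 3 = 48 := by norm_num [Nat.factorial]
    rw [h48] at h
    have hexp : 0 < Real.exp (w / 2) := Real.exp_pos _
    have e : Real.exp (-(1 / 2 * w)) * Real.exp (w / 2) = 1 := by rw [← Real.exp_add]; ring_nf; simp
    calc w ^ 3 = w ^ 3 * Real.exp (-(1 / 2 * w)) * Real.exp (w / 2) := by rw [mul_assoc, e, mul_one]
      _ ≤ 48 * Real.exp (w / 2) := mul_le_mul_of_nonneg_right h hexp.le

set_option maxHeartbeats 800000 in
/-- **(E0)** the exceptional prime powers of (2.6): `4(π(z) + ω(q)) log²(2X+h) ≤ 2500 X T'` when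
`π(z) ≤ z + 1`, `ω(q) ≤ 2 log X = 2uL_z`, `log(2X+h) ≤ 2uL_z`, `X = e^{uL_z}`, `z = e^{L_z}`, `u ≥ 2`,
`L_z ≥ 10⁴C²u`, `e^{−10C²u} ≤ T'`. [cite: MatomakiMerikoski2023, §7 (7.1)] -/
theorem eq71_E0_le {C u Lz X z T cz cq L₂ : ℝ} (hC : 1 ≤ C) (hu2 : 2 ≤ u) (hLz : 10 ^ 4 * C ^ 2 * u ≤ Lz)
    (hX : X = Real.exp (u * Lz)) (hz : z = Real.exp Lz) (hT : Real.exp (-(10 * C ^ 2 * u)) ≤ T)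
    (hcz : cz ≤ z + 1) (hcq : cq ≤ 2 * u * Lz) (hL₂0 : 0 ≤ L₂)
    (hL₂ : L₂ ≤ 2 * u * Lz) :
    4 * (cz + cq) * L₂ ^ 2 ≤ 2500 * X * T := by
  have hC2 : 1 ≤ C ^ 2 := one_le_pow₀ hC
  have hf2 : ((2 : ℕ).factorial : ℝ) = 2 := by norm_num [Nat.factorial]
  have hu0 : 0 < u := by linarith
  have hu1 : 1 ≤ u := by linarith
  have hCu : 2 ≤ C ^ 2 * u := by nlinarith [mul_nonneg (sub_nonneg.mpr hC2) (sub_nonneg.mpr hu2)]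
  have hLz1 : 2 * 10 ^ 4 ≤ Lz := by nlinarith
  have hLz0 : 0 < Lz := by linarith
  have hX0 : 0 < X := by rw [hX]; exact Real.exp_pos _
  have hz1 : 1 ≤ z := by rw [hz]; exact Real.one_le_exp (by linarith)
  have hT0 : 0 < T := lt_of_lt_of_le (Real.exp_pos _) hT
  obtain ⟨hLz2, hcube⟩ := Lz_aux hLz0.le (show 0 ≤ u * Lz by positivity)
  -- `e^{Lz} ≤ X e^{−Lz}` (`u ≥ 2`), `e^{−Lz/2} ≤ e^{−5000C²u}`, `e^{uLz/2} ≤ X e^{−Lz}`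
  have hzX : Real.exp Lz ≤ X * Real.exp (-Lz) := by
    rw [hX, ← Real.exp_add, Real.exp_le_exp]; nlinarith
  have hhalf : Real.exp (-(Lz / 2)) ≤ Real.exp (-(5000 * C ^ 2 * u)) := by
    rw [Real.exp_le_exp]; linarith
  have hsqrt : Real.exp (u * Lz / 2) ≤ X * Real.exp (-Lz) := by
    rw [hX, ← Real.exp_add, Real.exp_le_exp]; nlinarith
  -- `u² e^{−5000C²u} ≤ 2 T`, `e^{−Lz} ≤ T`
  have hu2T : u ^ 2 * Real.exp (-(5000 * C ^ 2 * u)) ≤ 2 * T := by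
    have h := pow_mul_exp_le_factorial_mul_exp 2 hu0.le (show 10 * C ^ 2 + 1 ≤ 5000 * C ^ 2 by nlinarith)
    refine h.trans ?_
    rw [hf2]; linarith
  have hLzT : Real.exp (-Lz) ≤ T := by
    refine le_trans ?_ hT
    rw [Real.exp_le_exp]; nlinarith
  -- first piece: `u² Lz² (z + 1) ≤ 32 X T`
  have hp1 : u ^ 2 * Lz ^ 2 * (z + 1) ≤ 32 * X * T := by
    have h1 : z + 1 ≤ 2 * Real.exp Lz := by rw [hz]; linarith [Real.one_le_exp (by linarith : (0:ℝ) ≤ Lz), hz1]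
    calc u ^ 2 * Lz ^ 2 * (z + 1) ≤ u ^ 2 * Lz ^ 2 * (2 * (X * Real.exp (-Lz))) := by
          gcongr; exact h1.trans (by linarith)
      _ = 2 * X * u ^ 2 * (Lz ^ 2 * Real.exp (-Lz)) := by ring
      _ ≤ 2 * X * u ^ 2 * (8 * Real.exp (-(Lz / 2))) := by gcongr
      _ ≤ 2 * X * u ^ 2 * (8 * Real.exp (-(5000 * C ^ 2 * u))) := by gcongr
      _ = 16 * X * (u ^ 2 * Real.exp (-(5000 * C ^ 2 * u))) := by ring
      _ ≤ 16 * X * (2 * T) := by gcongr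
      _ = 32 * X * T := by ring
  -- second piece: `u³ Lz³ ≤ 48 X T`
  have hp2 : u ^ 3 * Lz ^ 3 ≤ 48 * X * T := by
    calc u ^ 3 * Lz ^ 3 = (u * Lz) ^ 3 := by ring
      _ ≤ 48 * Real.exp (u * Lz / 2) := hcube
      _ ≤ 48 * (X * Real.exp (-Lz)) := by gcongr
      _ ≤ 48 * (X * T) := by gcongr
      _ = 48 * X * T := by ring
  -- assemble
  have hsum : cz + cq ≤ (z + 1) + 2 * u * Lz := add_le_add hcz hcq
  have hL₂2 : L₂ ^ 2 ≤ (2 * u * Lz) ^ 2 := pow_le_pow_left₀ hL₂0 hL₂ 2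
  calc 4 * (cz + cq) * L₂ ^ 2 ≤ 4 * ((z + 1) + 2 * u * Lz) * (2 * u * Lz) ^ 2 := by
        gcongr
    _ = 16 * (u ^ 2 * Lz ^ 2 * (z + 1)) + 32 * (u ^ 3 * Lz ^ 3) := by ring
    _ ≤ 16 * (32 * X * T) + 32 * (48 * X * T) := by gcongr
    _ = 2048 * X * T := by ring
    _ ≤ 2500 * X * T := by nlinarith [mul_pos hX0 hT0]

set_option maxHeartbeats 800000 in
/-- **(E1)** the `c_n`-half (tree: `…CnHalf…`) times `log(2X+h)`:
`L₂ · K₁ F N (l_N/L_z²)(B_v + (v/η) l_N/L_z + (1/z)(l_N/L_z)²) ≤ 1400 K₁ F X T'` under the parameter facts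
(`N ≤ 2X`, `l_N ≤ uL_z + 1`, `L₂ ≤ 2uL_z`, `B_v ≤ (1+u²)e^{−50C²u}`, `v/η ≤ P`, `u³P ≤ 15T'`, `z = e^{L_z}`).
[cite: MatomakiMerikoski2023, §7 (7.1)] -/
theorem eq71_E1_le {C u Lz X z T K₁ F Nn lN L₂ Bv vη P : ℝ} (hC : 1 ≤ C) (hu2 : 2 ≤ u)
    (hLz : 10 ^ 4 * C ^ 2 * u ≤ Lz) (hX0 : 0 < X) (hz : z = Real.exp Lz)
    (hT : Real.exp (-(10 * C ^ 2 * u)) ≤ T) (hK₁ : 0 ≤ K₁) (hF : 0 ≤ F)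
    (hN : Nn ≤ 2 * X) (hlN0 : 0 ≤ lN) (hlN : lN ≤ u * Lz + 1) (hL₂0 : 0 ≤ L₂)
    (hL₂ : L₂ ≤ 2 * u * Lz) (hBv0 : 0 ≤ Bv) (hBv : Bv ≤ (1 + u ^ 2) * Real.exp (-(50 * C ^ 2 * u)))
    (hvη0 : 0 ≤ vη) (hvη : vη ≤ P) (hP : u ^ 3 * P ≤ 15 * T) :
    L₂ * (K₁ * F * Nn * (lN / Lz ^ 2) * (Bv + vη * (lN / Lz) + 1 / z * (lN / Lz) ^ 2)) ≤
      1400 * K₁ * F * X * T := by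
  have hC2 : 1 ≤ C ^ 2 := one_le_pow₀ hC
  have hf4 : ((4 : ℕ).factorial : ℝ) = 24 := by norm_num [Nat.factorial]
  have hu0 : 0 < u := by linarith
  have hu1 : 1 ≤ u := by linarith
  have hCu : 2 ≤ C ^ 2 * u := by nlinarith [mul_nonneg (sub_nonneg.mpr hC2) (sub_nonneg.mpr hu2)]
  have hLz1 : 2 * 10 ^ 4 ≤ Lz := by nlinarith
  have hLz0 : 0 < Lz := by linarith
  have hT0 : 0 < T := lt_of_lt_of_le (Real.exp_pos _) hT
  have hP0 : 0 ≤ P := hvη0.trans hvη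
  -- `l_N/L_z ≤ 2u`
  have hr : lN / Lz ≤ 2 * u := by
    rw [div_le_iff₀ hLz0]
    have : 1 ≤ u * Lz := by nlinarith
    nlinarith
  have hr0 : 0 ≤ lN / Lz := by positivity
  -- `L₂ l_N / L_z² ≤ 4u²`
  have hLl : L₂ * (lN / Lz ^ 2) ≤ 4 * u ^ 2 := by
    have e : L₂ * (lN / Lz ^ 2) = (L₂ / Lz) * (lN / Lz) := by field_simp
    rw [e]
    have h1 : L₂ / Lz ≤ 2 * u := by rw [div_le_iff₀ hLz0]; linarith
    have h10 : 0 ≤ L₂ / Lz := by positivity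
    calc L₂ / Lz * (lN / Lz) ≤ (2 * u) * (2 * u) := mul_le_mul h1 hr hr0 (by positivity)
      _ = 4 * u ^ 2 := by ring
  -- the bracket
  have hz0 : 0 < z := by rw [hz]; exact Real.exp_pos _
  have hbr : Bv + vη * (lN / Lz) + 1 / z * (lN / Lz) ^ 2 ≤
      2 * u ^ 2 * Real.exp (-(50 * C ^ 2 * u)) + 2 * u * P + 4 * u ^ 2 * Real.exp (-(10 ^ 4 * C ^ 2 * u)) := by
    have h2u : 1 + u ^ 2 ≤ 2 * u ^ 2 := by
      have := one_le_pow₀ (M₀ := ℝ) hu1 (n := 2); linarith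
    have h1 : Bv ≤ 2 * u ^ 2 * Real.exp (-(50 * C ^ 2 * u)) :=
      hBv.trans (mul_le_mul_of_nonneg_right h2u (Real.exp_pos _).le)
    have h2 : vη * (lN / Lz) ≤ 2 * u * P := by
      calc vη * (lN / Lz) ≤ P * (2 * u) := mul_le_mul hvη hr hr0 hP0
        _ = 2 * u * P := by ring
    have h3 : 1 / z * (lN / Lz) ^ 2 ≤ 4 * u ^ 2 * Real.exp (-(10 ^ 4 * C ^ 2 * u)) := by
      have hz' : 1 / z ≤ Real.exp (-(10 ^ 4 * C ^ 2 * u)) := by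
        rw [hz, one_div, ← Real.exp_neg, Real.exp_le_exp]; linarith
      have hsq : (lN / Lz) ^ 2 ≤ (2 * u) ^ 2 := pow_le_pow_left₀ hr0 hr 2
      calc 1 / z * (lN / Lz) ^ 2 ≤ Real.exp (-(10 ^ 4 * C ^ 2 * u)) * (2 * u) ^ 2 :=
            mul_le_mul hz' hsq (by positivity) (Real.exp_pos _).le
        _ = 4 * u ^ 2 * Real.exp (-(10 ^ 4 * C ^ 2 * u)) := by ring
    linarith
  -- the three monomials against `T`
  have hm1 : u ^ 4 * Real.exp (-(50 * C ^ 2 * u)) ≤ 24 * T := by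
    have h := pow_mul_exp_le_factorial_mul_exp 4 hu0.le (show 10 * C ^ 2 + 1 ≤ 50 * C ^ 2 by nlinarith)
    refine h.trans ?_
    rw [hf4]; linarith
  have hm3 : u ^ 4 * Real.exp (-(10 ^ 4 * C ^ 2 * u)) ≤ 24 * T := by
    have h := pow_mul_exp_le_factorial_mul_exp 4 hu0.le (show 10 * C ^ 2 + 1 ≤ 10 ^ 4 * C ^ 2 by nlinarith)
    refine h.trans ?_
    rw [hf4]; linarith
  -- assemble: `L₂ K₁ F N (l/L²) B ≤ K₁ F (2X) (4u²) B`
  have hbr0 : 0 ≤ Bv + vη * (lN / Lz) + 1 / z * (lN / Lz) ^ 2 := by positivity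
  calc L₂ * (K₁ * F * Nn * (lN / Lz ^ 2) * (Bv + vη * (lN / Lz) + 1 / z * (lN / Lz) ^ 2))
      = K₁ * F * Nn * (L₂ * (lN / Lz ^ 2)) * (Bv + vη * (lN / Lz) + 1 / z * (lN / Lz) ^ 2) := by ring
    _ ≤ K₁ * F * (2 * X) * (4 * u ^ 2) *
        (2 * u ^ 2 * Real.exp (-(50 * C ^ 2 * u)) + 2 * u * P + 4 * u ^ 2 * Real.exp (-(10 ^ 4 * C ^ 2 * u))) := by
        gcongr
    _ = 8 * K₁ * F * X * (2 * (u ^ 4 * Real.exp (-(50 * C ^ 2 * u))) + 2 * (u ^ 3 * P) +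
        4 * (u ^ 4 * Real.exp (-(10 ^ 4 * C ^ 2 * u)))) := by ring
    _ ≤ 8 * K₁ * F * X * (2 * (24 * T) + 2 * (15 * T) + 4 * (24 * T)) := by gcongr
    _ = 1392 * K₁ * F * X * T := by ring
    _ ≤ 1400 * K₁ * F * X * T := by
        have : 0 ≤ K₁ * F * X * T := by positivity
        nlinarith

set_option maxHeartbeats 800000 in
/-- **(E2a)** the main part of the `τ(n) c_{n+h}`-half (tree: `…CnTau…`) times `log(2X+h)`:
`L₂ · K₂ F 2^{l_N/L_z} e^{(l_M/L_z)/(z−1)} (M l_M/L_z²)(B_v + (v/η) l_M/L_z) ≤ 10⁸ K₂ F X T'` under the parameter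
facts (`M ≤ 3X`, `l_M ≤ uL_z + 2`, `u³e^{7u/10}P ≤ 48000 T'`, …). [cite: MatomakiMerikoski2023, §7 (7.1)] -/
theorem eq71_E2a_le {C u Lz X z T K₂ F M lM lN L₂ Bv vη P : ℝ} (hC : 1 ≤ C) (hu2 : 2 ≤ u)
    (hLz : 10 ^ 4 * C ^ 2 * u ≤ Lz) (hX0 : 0 < X) (hz : z = Real.exp Lz)
    (hT : Real.exp (-(10 * C ^ 2 * u)) ≤ T) (hK₂ : 0 ≤ K₂) (hF : 0 ≤ F)
    (hM0 : 0 ≤ M) (hM : M ≤ 3 * X) (hlM0 : 0 ≤ lM) (hlM : lM ≤ u * Lz + 2) (hlN0 : 0 ≤ lN)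
    (hlN : lN ≤ u * Lz + 1) (hL₂0 : 0 ≤ L₂) (hL₂ : L₂ ≤ 2 * u * Lz) (hBv0 : 0 ≤ Bv)
    (hBv : Bv ≤ (1 + u ^ 2) * Real.exp (-(50 * C ^ 2 * u))) (hvη0 : 0 ≤ vη) (hvη : vη ≤ P)
    (hP : u ^ 3 * Real.exp ((7 / 10 : ℝ) * u) * P ≤ 48000 * T) :
    L₂ * (K₂ * F * (2 : ℝ) ^ (lN / Lz) * Real.exp ((lM / Lz) / (z - 1)) * (M * lM / Lz ^ 2) *
        (Bv + vη * (lM / Lz))) ≤ 10 ^ 8 * K₂ * F * X * T := by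
  have hC2 : 1 ≤ C ^ 2 := one_le_pow₀ hC
  have hf4 : ((4 : ℕ).factorial : ℝ) = 24 := by norm_num [Nat.factorial]
  have hu0 : 0 < u := by linarith
  have hu1 : 1 ≤ u := by linarith
  have hCu : 2 ≤ C ^ 2 * u := by nlinarith [mul_nonneg (sub_nonneg.mpr hC2) (sub_nonneg.mpr hu2)]
  have hLz1 : 2 * 10 ^ 4 ≤ Lz := by nlinarith
  have hLz0 : 0 < Lz := by linarith
  have hT0 : 0 < T := lt_of_lt_of_le (Real.exp_pos _) hT
  have hP0 : 0 ≤ P := hvη0.trans hvη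
  have huLz1 : 2 ≤ u * Lz := by nlinarith
  -- ratios
  have hrN : lN / Lz ≤ u + 1 := by
    rw [div_le_iff₀ hLz0]; nlinarith
  have hrM : lM / Lz ≤ u + 1 := by
    rw [div_le_iff₀ hLz0]; nlinarith
  have hrM0 : 0 ≤ lM / Lz := by positivity
  -- `2^{l_N/L_z} ≤ 3 e^{(7 / 10 : ℝ)u}`
  have h2pow : (2 : ℝ) ^ (lN / Lz) ≤ 3 * Real.exp ((7 / 10 : ℝ) * u) := by
    have h1 := (two_rpow_le_exp (show 0 ≤ lN / Lz by positivity)).1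
    refine h1.trans ?_
    have h2 : Real.exp ((7 / 10 : ℝ) * (lN / Lz)) ≤ Real.exp ((7 / 10 : ℝ) * (u + 1)) := by
      rw [Real.exp_le_exp]; nlinarith
    refine h2.trans ?_
    rw [show (7 / 10 : ℝ) * (u + 1) = (7 / 10 : ℝ) + (7 / 10 : ℝ) * u by ring, Real.exp_add]
    refine mul_le_mul_of_nonneg_right ?_ (Real.exp_pos _).le
    have := Real.exp_one_lt_d9
    have h3 : Real.exp (7 / 10 : ℝ) ≤ Real.exp 1 := Real.exp_le_exp.mpr (by norm_num)
    linarith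
  -- `e^{(l_M/L_z)/(z−1)} ≤ 3`
  have hz1 : u + 1 ≤ z - 1 := by
    rw [hz]
    have := Real.add_one_le_exp Lz
    nlinarith
  have hefac : Real.exp ((lM / Lz) / (z - 1)) ≤ 3 := by
    have hz2 : 0 < z - 1 := by linarith
    have h1 : (lM / Lz) / (z - 1) ≤ 1 := by
      rw [div_le_one hz2]; linarith
    calc Real.exp ((lM / Lz) / (z - 1)) ≤ Real.exp 1 := Real.exp_le_exp.mpr h1
      _ ≤ 3 := by have := Real.exp_one_lt_d9; linarith
  -- `L₂ · M l_M/L_z² ≤ 12 X u²`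
  have hLM : L₂ * (M * lM / Lz ^ 2) ≤ 12 * X * u ^ 2 := by
    have e : L₂ * (M * lM / Lz ^ 2) = M * ((L₂ / Lz) * (lM / Lz)) := by field_simp
    rw [e]
    have h1 : L₂ / Lz ≤ 2 * u := by rw [div_le_iff₀ hLz0]; linarith
    have h10 : 0 ≤ L₂ / Lz := by positivity
    have h2 : (L₂ / Lz) * (lM / Lz) ≤ (2 * u) * (u + 1) := mul_le_mul h1 hrM hrM0 (by positivity)
    have hu2u : u ^ 2 + u ≤ 2 * u ^ 2 := by nlinarith
    calc M * ((L₂ / Lz) * (lM / Lz)) ≤ (3 * X) * ((2 * u) * (u + 1)) :=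
          mul_le_mul hM h2 (by positivity) (by positivity)
      _ = 6 * X * (u ^ 2 + u) := by ring
      _ ≤ 6 * X * (2 * u ^ 2) := mul_le_mul_of_nonneg_left hu2u (by positivity)
      _ = 12 * X * u ^ 2 := by ring
  -- the bracket
  have hbr : Bv + vη * (lM / Lz) ≤ 2 * u ^ 2 * Real.exp (-(50 * C ^ 2 * u)) + 2 * u * P := by
    have h2u : 1 + u ^ 2 ≤ 2 * u ^ 2 := by
      have := one_le_pow₀ (M₀ := ℝ) hu1 (n := 2); linarith
    have h1 : Bv ≤ 2 * u ^ 2 * Real.exp (-(50 * C ^ 2 * u)) :=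
      hBv.trans (mul_le_mul_of_nonneg_right h2u (Real.exp_pos _).le)
    have h2 : vη * (lM / Lz) ≤ 2 * u * P := by
      calc vη * (lM / Lz) ≤ P * (u + 1) := mul_le_mul hvη hrM hrM0 hP0
        _ ≤ P * (2 * u) := mul_le_mul_of_nonneg_left (by linarith) hP0
        _ = 2 * u * P := by ring
    linarith
  have hbr0 : 0 ≤ Bv + vη * (lM / Lz) := by positivity
  -- monomials
  have hm1 : u ^ 4 * Real.exp ((7 / 10 : ℝ) * u) * Real.exp (-(50 * C ^ 2 * u)) ≤ 24 * T := by
    have e : u ^ 4 * Real.exp ((7 / 10 : ℝ) * u) * Real.exp (-(50 * C ^ 2 * u)) =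
        u ^ 4 * Real.exp (-((50 * C ^ 2 - (7 / 10 : ℝ)) * u)) := by
      rw [mul_assoc, ← Real.exp_add]; ring_nf
    rw [e]
    have h := pow_mul_exp_le_factorial_mul_exp 4 hu0.le (show 10 * C ^ 2 + 1 ≤ 50 * C ^ 2 - (7 / 10 : ℝ) by nlinarith)
    refine h.trans ?_
    rw [hf4]; linarith
  -- assemble
  have hLM0 : 0 ≤ L₂ * (M * lM / Lz ^ 2) := by positivity
  have hs1 : K₂ * F * (2 : ℝ) ^ (lN / Lz) ≤ K₂ * F * (3 * Real.exp ((7 / 10 : ℝ) * u)) :=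
    mul_le_mul_of_nonneg_left h2pow (by positivity)
  have hs2 : K₂ * F * (2 : ℝ) ^ (lN / Lz) * Real.exp ((lM / Lz) / (z - 1)) ≤
      K₂ * F * (3 * Real.exp ((7 / 10 : ℝ) * u)) * 3 :=
    mul_le_mul hs1 hefac (Real.exp_pos _).le (by positivity)
  have hs3 : K₂ * F * (2 : ℝ) ^ (lN / Lz) * Real.exp ((lM / Lz) / (z - 1)) * (L₂ * (M * lM / Lz ^ 2)) ≤
      K₂ * F * (3 * Real.exp ((7 / 10 : ℝ) * u)) * 3 * (12 * X * u ^ 2) :=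
    mul_le_mul hs2 hLM hLM0 (by positivity)
  have hs4 : K₂ * F * (2 : ℝ) ^ (lN / Lz) * Real.exp ((lM / Lz) / (z - 1)) * (L₂ * (M * lM / Lz ^ 2)) *
        (Bv + vη * (lM / Lz)) ≤
      K₂ * F * (3 * Real.exp ((7 / 10 : ℝ) * u)) * 3 * (12 * X * u ^ 2) *
        (2 * u ^ 2 * Real.exp (-(50 * C ^ 2 * u)) + 2 * u * P) :=
    mul_le_mul hs3 hbr hbr0 (by positivity)
  calc L₂ * (K₂ * F * (2 : ℝ) ^ (lN / Lz) * Real.exp ((lM / Lz) / (z - 1)) * (M * lM / Lz ^ 2) *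
        (Bv + vη * (lM / Lz)))
      = K₂ * F * (2 : ℝ) ^ (lN / Lz) * Real.exp ((lM / Lz) / (z - 1)) * (L₂ * (M * lM / Lz ^ 2)) *
        (Bv + vη * (lM / Lz)) := by ring
    _ ≤ K₂ * F * (3 * Real.exp ((7 / 10 : ℝ) * u)) * 3 * (12 * X * u ^ 2) *
        (2 * u ^ 2 * Real.exp (-(50 * C ^ 2 * u)) + 2 * u * P) := hs4
    _ = 108 * K₂ * F * X * (2 * (u ^ 4 * Real.exp ((7 / 10 : ℝ) * u) * Real.exp (-(50 * C ^ 2 * u))) +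
        2 * (u ^ 3 * Real.exp ((7 / 10 : ℝ) * u) * P)) := by ring
    _ ≤ 108 * K₂ * F * X * (2 * (24 * T) + 2 * (48000 * T)) := by gcongr
    _ = 10373184 * K₂ * F * X * T := by ring
    _ ≤ 10 ^ 8 * K₂ * F * X * T := by
        have : 0 ≤ K₂ * F * X * T := by positivity
        nlinarith

set_option maxHeartbeats 800000 in
/-- **(E2b)** the non-square-free and boundary part of the `τ(n) c_{n+h}`-half times `log(2X+h)`:
`L₂ · K₂ 4^{l_M/L_z} l_M (M/(z−1) + √M + 1) ≤ 4608 K₂ X T'`. [cite: MatomakiMerikoski2023, §7 (7.1)] -/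
theorem eq71_E2b_le {C u Lz X z T K₂ M lM L₂ : ℝ} (hC : 1 ≤ C) (hu2 : 2 ≤ u)
    (hLz : 10 ^ 4 * C ^ 2 * u ≤ Lz) (hX : X = Real.exp (u * Lz)) (hz : z = Real.exp Lz)
    (hT : Real.exp (-(10 * C ^ 2 * u)) ≤ T) (hK₂ : 0 ≤ K₂)
    (hM0 : 0 ≤ M) (hM : M ≤ 3 * X) (hlM0 : 0 ≤ lM) (hlM : lM ≤ u * Lz + 2) (hL₂0 : 0 ≤ L₂)
    (hL₂ : L₂ ≤ 2 * u * Lz) :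
    L₂ * (K₂ * (4 : ℝ) ^ (lM / Lz) * lM * (M / (z - 1) + Real.sqrt M + 1)) ≤ 4608 * K₂ * X * T := by
  have hC2 : 1 ≤ C ^ 2 := one_le_pow₀ hC
  have hf2 : ((2 : ℕ).factorial : ℝ) = 2 := by norm_num [Nat.factorial]
  have hu0 : 0 < u := by linarith
  have hu1 : 1 ≤ u := by linarith
  have hCu : 2 ≤ C ^ 2 * u := by nlinarith [mul_nonneg (sub_nonneg.mpr hC2) (sub_nonneg.mpr hu2)]
  have hLz1 : 2 * 10 ^ 4 ≤ Lz := by nlinarith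
  have hLz0 : 0 < Lz := by linarith
  have hT0 : 0 < T := lt_of_lt_of_le (Real.exp_pos _) hT
  have hX0 : 0 < X := by rw [hX]; exact Real.exp_pos _
  have hX1 : 1 ≤ X := by rw [hX]; exact Real.one_le_exp (by positivity)
  have huLz1 : 2 ≤ u * Lz := by nlinarith
  obtain ⟨hLz2, -⟩ := Lz_aux hLz0.le hLz0.le
  -- `4^{l_M/L_z} ≤ 5 e^{(7 / 5 : ℝ)u}`
  have hrM : lM / Lz ≤ u + 1 := by rw [div_le_iff₀ hLz0]; nlinarith
  have h4pow : (4 : ℝ) ^ (lM / Lz) ≤ 8 * Real.exp ((7 / 5 : ℝ) * u) := by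
    have h1 := (two_rpow_le_exp (show 0 ≤ lM / Lz by positivity)).2
    refine h1.trans ?_
    have h2 : Real.exp ((7 / 5 : ℝ) * (lM / Lz)) ≤ Real.exp ((7 / 5 : ℝ) * (u + 1)) := by
      rw [Real.exp_le_exp]; nlinarith
    refine h2.trans ?_
    rw [show (7 / 5 : ℝ) * (u + 1) = 1 + 1 + ((7 / 5 : ℝ) * u - (3 / 5 : ℝ)) by ring, Real.exp_add, Real.exp_add]
    have := Real.exp_one_lt_d9
    have h5 : 0 ≤ Real.exp 1 := (Real.exp_pos _).le
    have h6 : Real.exp 1 * Real.exp 1 ≤ 8 := by nlinarith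
    have h7 : Real.exp ((7 / 5 : ℝ) * u - (3 / 5 : ℝ)) ≤ Real.exp ((7 / 5 : ℝ) * u) := Real.exp_le_exp.mpr (by linarith)
    exact mul_le_mul h6 h7 (Real.exp_pos _).le (by norm_num)
  -- `M/(z−1) + √M + 1 ≤ 6 X e^{−L_z} + 3 √X` and `√X ≤ X e^{−L_z}`
  have hzbig : 2 ≤ z := by
    rw [hz]; have := Real.add_one_le_exp Lz; linarith
  have hsqrtX : Real.sqrt X ≤ X * Real.exp (-Lz) := by
    have e : Real.sqrt X = Real.exp (u * Lz / 2) := by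
      rw [hX, Real.sqrt_eq_rpow, ← Real.exp_mul]; ring_nf
    rw [e, hX, ← Real.exp_add, Real.exp_le_exp]; nlinarith
  have htail : M / (z - 1) + Real.sqrt M + 1 ≤ 9 * (X * Real.exp (-Lz)) := by
    have h1 : M / (z - 1) ≤ 6 * (X * Real.exp (-Lz)) := by
      have hz2 : 0 < z - 1 := by linarith
      rw [div_le_iff₀ hz2]
      have e : Real.exp (-Lz) * z = 1 := by rw [hz, ← Real.exp_add]; simp
      have : 6 * (X * Real.exp (-Lz)) * (z - 1) = 6 * X - 6 * X * Real.exp (-Lz) := by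
        have : 6 * (X * Real.exp (-Lz)) * (z - 1) = 6 * X * (Real.exp (-Lz) * z) - 6 * X * Real.exp (-Lz) := by ring
        rw [this, e, mul_one]
      rw [this]
      have h3 : X * Real.exp (-Lz) ≤ X * (1 / 2) := by
        refine mul_le_mul_of_nonneg_left ?_ hX0.le
        rw [Real.exp_neg]
        have hz' : 2 ≤ Real.exp Lz := by rw [← hz]; exact hzbig
        rw [inv_le_comm₀ (Real.exp_pos _) (by norm_num)]; norm_num; exact hz'
      nlinarith
    have h2 : Real.sqrt M ≤ 2 * Real.sqrt X := by
      calc Real.sqrt M ≤ Real.sqrt (3 * X) := Real.sqrt_le_sqrt hM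
        _ ≤ Real.sqrt (4 * X) := Real.sqrt_le_sqrt (by linarith)
        _ = 2 * Real.sqrt X := by
            rw [Real.sqrt_mul (by norm_num), show (4:ℝ) = 2 ^ 2 by norm_num, Real.sqrt_sq (by norm_num)]
    have h3 : 1 ≤ Real.sqrt X := by rw [show (1:ℝ) = Real.sqrt 1 by simp]; exact Real.sqrt_le_sqrt hX1
    linarith
  -- `u² L_z² e^{(7 / 5 : ℝ)u} X e^{−L_z} ≤ 16 X T`
  have hcore : u ^ 2 * Lz ^ 2 * Real.exp ((7 / 5 : ℝ) * u) * (X * Real.exp (-Lz)) ≤ 16 * X * T := by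
    have h1 : Real.exp (-(Lz / 2)) ≤ Real.exp (-(5000 * C ^ 2 * u)) := by
      rw [Real.exp_le_exp]; linarith
    have hm : u ^ 2 * Real.exp ((7 / 5 : ℝ) * u) * Real.exp (-(5000 * C ^ 2 * u)) ≤ 2 * T := by
      have e : u ^ 2 * Real.exp ((7 / 5 : ℝ) * u) * Real.exp (-(5000 * C ^ 2 * u)) =
          u ^ 2 * Real.exp (-((5000 * C ^ 2 - (7 / 5 : ℝ)) * u)) := by
        rw [mul_assoc, ← Real.exp_add]; ring_nf
      rw [e]
      have h := pow_mul_exp_le_factorial_mul_exp 2 hu0.le (show 10 * C ^ 2 + 1 ≤ 5000 * C ^ 2 - (7 / 5 : ℝ) by nlinarith)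
      refine h.trans ?_
      rw [hf2]; linarith
    calc u ^ 2 * Lz ^ 2 * Real.exp ((7 / 5 : ℝ) * u) * (X * Real.exp (-Lz))
        = X * (u ^ 2 * Real.exp ((7 / 5 : ℝ) * u)) * (Lz ^ 2 * Real.exp (-Lz)) := by ring
      _ ≤ X * (u ^ 2 * Real.exp ((7 / 5 : ℝ) * u)) * (8 * Real.exp (-(Lz / 2))) := by gcongr
      _ ≤ X * (u ^ 2 * Real.exp ((7 / 5 : ℝ) * u)) * (8 * Real.exp (-(5000 * C ^ 2 * u))) := by gcongr
      _ = 8 * X * (u ^ 2 * Real.exp ((7 / 5 : ℝ) * u) * Real.exp (-(5000 * C ^ 2 * u))) := by ring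
      _ ≤ 8 * X * (2 * T) := by gcongr
      _ = 16 * X * T := by ring
  -- assemble
  have htail0 : 0 ≤ M / (z - 1) + Real.sqrt M + 1 := by
    have : 0 < z - 1 := by linarith
    positivity
  have hlM2 : lM ≤ 2 * u * Lz := by nlinarith
  have hb1 : K₂ * (4 : ℝ) ^ (lM / Lz) ≤ K₂ * (8 * Real.exp ((7 / 5 : ℝ) * u)) := mul_le_mul_of_nonneg_left h4pow hK₂
  have hb2 : L₂ * lM ≤ (2 * u * Lz) * (2 * u * Lz) := mul_le_mul hL₂ hlM2 hlM0 (by positivity)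
  have hb3 : K₂ * (4 : ℝ) ^ (lM / Lz) * (L₂ * lM) ≤ K₂ * (8 * Real.exp ((7 / 5 : ℝ) * u)) * ((2 * u * Lz) * (2 * u * Lz)) :=
    mul_le_mul hb1 hb2 (by positivity) (by positivity)
  have hb4 : K₂ * (4 : ℝ) ^ (lM / Lz) * (L₂ * lM) * (M / (z - 1) + Real.sqrt M + 1) ≤
      K₂ * (8 * Real.exp ((7 / 5 : ℝ) * u)) * ((2 * u * Lz) * (2 * u * Lz)) * (9 * (X * Real.exp (-Lz))) :=
    mul_le_mul hb3 htail htail0 (by positivity)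
  calc L₂ * (K₂ * (4 : ℝ) ^ (lM / Lz) * lM * (M / (z - 1) + Real.sqrt M + 1))
      = K₂ * (4 : ℝ) ^ (lM / Lz) * (L₂ * lM) * (M / (z - 1) + Real.sqrt M + 1) := by ring
    _ ≤ K₂ * (8 * Real.exp ((7 / 5 : ℝ) * u)) * ((2 * u * Lz) * (2 * u * Lz)) * (9 * (X * Real.exp (-Lz))) := hb4
    _ = 288 * K₂ * (u ^ 2 * Lz ^ 2 * Real.exp ((7 / 5 : ℝ) * u) * (X * Real.exp (-Lz))) := by ring
    _ ≤ 288 * K₂ * (16 * X * T) := by gcongr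
    _ = 4608 * K₂ * X * T := by ring

/-! ### (7.1), weak form -/

/-- `ℓ³ e^{−3ℓ/4} ≤ 15` and `ℓ³ e^{7ℓ/10} e^{−3ℓ/4} ≤ 48000` (`ℓ ≥ 0`). [folklore] -/
theorem cube_mul_exp_bounds {ℓ : ℝ} (hℓ : 0 ≤ ℓ) :
    ℓ ^ 3 * Real.exp (-(3 * ℓ / 4)) ≤ 15 ∧ ℓ ^ 3 * Real.exp ((7 / 10 : ℝ) * ℓ) * Real.exp (-(3 * ℓ / 4)) ≤ 48000 := by
  have hf3 : ((3 : ℕ).factorial : ℝ) = 6 := by norm_num [Nat.factorial]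
  constructor
  · have h := pow_mul_exp_neg_mul_le 3 (show (0 : ℝ) < 3 / 4 by norm_num) hℓ
    rw [hf3, show (3 : ℝ) / 4 * ℓ = 3 * ℓ / 4 by ring] at h
    refine h.trans ?_; norm_num
  · have h := pow_mul_exp_neg_mul_le 3 (show (0 : ℝ) < 1 / 20 by norm_num) hℓ
    rw [hf3] at h
    have e : Real.exp ((7 / 10 : ℝ) * ℓ) * Real.exp (-(3 * ℓ / 4)) = Real.exp (-(1 / 20 * ℓ)) := by
      rw [← Real.exp_add]; ring_nf
    rw [mul_assoc, e]
    refine h.trans ?_; norm_num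

set_option maxHeartbeats 1600000 in
/-- **Matomäki–Merikoski (7.1), weak form.**  For every `C ≥ 1` there are `η₀` and `K > 0` such that for every
primitive quadratic `χ (mod q)`, `q ≥ 3`, every `η ≥ η₀` with `log η ≤ (log q)/100` and `L(1 − 1/(η log q), χ) = 0`,
every `X ≥ q^{37/4}` with `V η^{−1/4} ≤ 1` (`V = log X/log q`, `ℓ = log η`, `u = min{√(Vℓ)/(10C), ℓ}`, `v = V/u`,
so that `q^v = X^{1/u} = z`), every weight `0 ≤ g ≤ 1` vanishing outside `[1, 2]` and every shift `1 ≤ h ≤ X`: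
`|∑_{n ≤ 2X} g(n/X)Λ(n)Λ(n+h) − ∑_{n ≤ 2X, adm} g(n/X)λ'(n)λ'(n+h)| ≤ K (h/φ(h)) X (exp(−C√(Vℓ)) + V η^{−1/4})`,
"adm" meaning that every prime factor of `n` and of `n + h` is `≥ q^v` and prime to `q` (`λ' = χ ∗ log`).
This is the first display of §7 of the source ((2.5)/(2.6) + Lemma 2.1 + Lemma 2.2 + the choice (7.2) of `u`),
with the printed third rate `V log⁶η/η` weakened to `V η^{−1/4}` (the tree's substitute for Lemma 2.1 loses `2^u`)
and the shift restricted to `h ≤ X`.  Inputs: `MatomakiMerikoski2023_eq26`,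
`sum_adm_charLog_sub_vonMangoldt_le_of_exceptionalZero` (`…CnHalf`),
`sum_adm_tau_mul_charLog_sub_vonMangoldt_shift_le_of_exceptionalZero` (`…CnTau`), `eq71_params`, `eq71_E*_le`.
[cite: MatomakiMerikoski2023, §7 (7.1)–(7.2), Lemmas 2.1–2.2] -/
theorem MatomakiMerikoski2023_eq71_weak (C : ℝ) (hC : 1 ≤ C) :
    ∃ η₀ K : ℝ, 0 < K ∧ ∀ (q : ℕ) [NeZero q], 3 ≤ q → ∀ χ : DirichletCharacter ℂ q, χ.IsPrimitive →
      χ.IsQuadratic → ∀ η : ℝ, η₀ ≤ η → Real.log η ≤ Real.log q / 100 →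
        χ.LFunction ((1 - 1 / (η * Real.log q) : ℝ) : ℂ) = 0 →
        ∀ X : ℝ, (q : ℝ) ^ (37 / 4 : ℝ) ≤ X →
          ∀ V ℓ u v : ℝ, V = Real.log X / Real.log q → ℓ = Real.log η →
            u = min (Real.sqrt (V * ℓ) / (10 * C)) ℓ → v = V / u → V * η ^ (-(1 / 4 : ℝ)) ≤ 1 →
            ∀ g : ℝ → ℝ, (∀ t, 0 ≤ g t) → (∀ t, g t ≤ 1) → (∀ t, g t ≠ 0 → 1 ≤ t ∧ t ≤ 2) →
              ∀ h : ℕ, 1 ≤ h → (h : ℝ) ≤ X →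
                |∑ n ∈ Icc 1 ⌊2 * X⌋₊, g (n / X) * Λ n * Λ (n + h) -
                    ∑ n ∈ (Icc 1 ⌊2 * X⌋₊).filter (fun n : ℕ =>
                      (∀ p ∈ n.primeFactors, (q : ℝ) ^ v ≤ (p : ℝ) ∧ ¬ p ∣ q) ∧
                        (∀ p ∈ (n + h).primeFactors, (q : ℝ) ^ v ≤ (p : ℝ) ∧ ¬ p ∣ q)),
                      g (n / X) * charLog χ n * charLog χ (n + h)| ≤
                  K * ((h : ℝ) / Nat.totient h) * X *
                    (Real.exp (-(C * Real.sqrt (V * ℓ))) + V * η ^ (-(1 / 4 : ℝ))) := by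
  obtain ⟨K₁, hK₁, H₁⟩ := sum_adm_charLog_sub_vonMangoldt_le_of_exceptionalZero
  obtain ⟨K₂, η₂, hK₂, H₂⟩ := sum_adm_tau_mul_charLog_sub_vonMangoldt_shift_le_of_exceptionalZero
  refine ⟨max (max η₂ 10) (Real.exp (44 * C ^ 2)), 2500 + 1400 * K₁ + 10 ^ 8 * K₂ + 4608 * K₂,
    by positivity, ?_⟩
  intro q _ hq χ hprim hquad η hη hηq hL X hX V ℓ u v hV hℓ hu hv hnorm g hg0 hg1 hgs h hh hhX
  -- thresholds
  have hη₂ : η₂ ≤ η := le_trans (le_trans (le_max_left _ _) (le_max_left _ _)) hη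
  have hη10 : 10 ≤ η := le_trans (le_trans (le_max_right _ _) (le_max_left _ _)) hη
  have hη0 : 0 < η := by linarith
  have hℓ44 : 44 * C ^ 2 ≤ ℓ := by
    have h1 : Real.exp (44 * C ^ 2) ≤ η := le_trans (le_max_right _ _) hη
    rw [hℓ, Real.le_log_iff_exp_le hη0]; exact h1
  have hC2 : 1 ≤ C ^ 2 := one_le_pow₀ hC
  have hℓ0 : 0 ≤ ℓ := by linarith
  have hℓ44' : 44 ≤ ℓ := by linarith
  -- parameters
  obtain ⟨hu2, huℓ, hV9, hVη, hlogq, hlogXeq, hLzu, hT, hBv⟩ :=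
    eq71_params hC hq hη10 hℓ44 hηq hX hV hℓ hu hnorm
  have hu0 : 0 < u := by linarith
  have hu1 : 1 ≤ u := by linarith
  have hV0 : 0 < V := by linarith
  have hV1 : 1 ≤ V := by linarith
  have hq3 : (3 : ℝ) ≤ q := by exact_mod_cast hq
  have hq0 : (0 : ℝ) < q := by linarith
  have hqpow : 0 < (q : ℝ) ^ (37 / 4 : ℝ) := Real.rpow_pos_of_pos hq0 _
  have hX0 : 0 < X := lt_of_lt_of_le hqpow hX
  have hlogX0 : 0 < Real.log X := by rw [hlogXeq]; positivity
  have hX1 : 1 < X := (Real.log_pos_iff hX0.le).mp hlogX0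
  set Lz : ℝ := Real.log X / u with hLz_def
  have hLz : 10 ^ 4 * C ^ 2 * u ≤ Lz := hLzu
  have hCu : 2 ≤ C ^ 2 * u := by nlinarith [mul_nonneg (sub_nonneg.mpr hC2) (sub_nonneg.mpr hu2)]
  have hLz1 : 2 * 10 ^ 4 ≤ Lz := by linarith
  have huCu : u ≤ C ^ 2 * u := le_mul_of_one_le_left hu0.le hC2
  have huLz : 2 * (2 * 10 ^ 4) ≤ u * Lz := mul_le_mul hu2 hLz1 (by norm_num) hu0.le
  have hLz0 : 0 < Lz := by linarith
  have hlogXu : Real.log X = u * Lz := by rw [hLz_def]; field_simp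
  have hXexp : X = Real.exp (u * Lz) := by rw [← hlogXu, Real.exp_log hX0]
  set T : ℝ := Real.exp (-(C * Real.sqrt (V * ℓ))) + V * η ^ (-(1 / 4 : ℝ)) with hT_def
  have hT0 : 0 < T := lt_of_lt_of_le (Real.exp_pos _) hT
  -- `z = q^v = e^{L_z}`
  have hv0 : 0 < v := by rw [hv]; positivity
  set z : ℝ := (q : ℝ) ^ v with hz_def
  have hzexp : z = Real.exp Lz := by
    rw [hz_def, Real.rpow_def_of_pos hq0, hv, hLz_def, hlogXeq]; congr 1; field_simp
  have hlogz : Real.log z = Lz := by rw [hzexp, Real.log_exp]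
  have hz0 : 0 < z := by rw [hzexp]; exact Real.exp_pos _
  have hzLz : 1 + Lz ≤ z := by rw [hzexp]; linarith [Real.add_one_le_exp Lz]
  have hz4 : 4 ≤ z := by linarith
  have hz2 : 2 ≤ z := by linarith
  have hzX : z < X := by
    -- `z² = e^{2L_z} ≤ e^{uL_z} = X` and `z > 1`
    have h1 : z * z ≤ X := by
      rw [hzexp, hXexp, ← Real.exp_add, Real.exp_le_exp]
      nlinarith [mul_nonneg (sub_nonneg.mpr hu2) hLz0.le]
    have hz1 : 1 < z := by linarith
    nlinarith [mul_pos hz0 (sub_pos.mpr hz1)]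
  -- the integer range `N = ⌊2X⌋`
  set Nn : ℕ := ⌊2 * X⌋₊ with hNn
  have hN2X : (Nn : ℝ) ≤ 2 * X := Nat.floor_le (by linarith)
  have hXN : X < (Nn : ℝ) := by
    have := Nat.lt_floor_add_one (2 * X); rw [← hNn] at this; linarith
  have hN1 : (1 : ℝ) < Nn := hX1.trans hXN
  have hN0 : (0 : ℝ) < Nn := by linarith
  have hzN : z < (Nn : ℝ) := hzX.trans hXN
  have hlogN : Real.log Nn ≤ u * Lz + 1 := by
    calc Real.log Nn ≤ Real.log (2 * X) := Real.log_le_log hN0 hN2X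
      _ = Real.log 2 + Real.log X := Real.log_mul (by norm_num) hX0.ne'
      _ ≤ u * Lz + 1 := by rw [hlogXu]; linarith [Real.log_two_lt_d9]
  have hlogN0 : 0 ≤ Real.log Nn := Real.log_nonneg hN1.le
  -- `M = N + h ≤ 3X`, its logarithm, and `L₂ = log(2X + h)`
  have hh0 : (0 : ℝ) < h := by exact_mod_cast hh
  have hM3 : (Nn : ℝ) + h ≤ 3 * X := by linarith
  have hM0 : 0 ≤ (Nn : ℝ) + h := by positivity
  have hlog3 : Real.log 3 ≤ 2 := by
    rw [Real.log_le_iff_le_exp (by norm_num)]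
    have := Real.exp_one_gt_d9
    have h2 : Real.exp 2 = Real.exp 1 * Real.exp 1 := by rw [← Real.exp_add]; norm_num
    rw [h2]; nlinarith
  have hlogM : Real.log ((Nn : ℝ) + h) ≤ u * Lz + 2 := by
    calc Real.log ((Nn : ℝ) + h) ≤ Real.log (3 * X) := Real.log_le_log (by positivity) hM3
      _ = Real.log 3 + Real.log X := Real.log_mul (by norm_num) hX0.ne'
      _ ≤ u * Lz + 2 := by rw [hlogXu]; linarith
  have hlogM0 : 0 ≤ Real.log ((Nn : ℝ) + h) := Real.log_nonneg (by linarith)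
  have hL₂ : Real.log (2 * X + h) ≤ 2 * u * Lz := by
    calc Real.log (2 * X + h) ≤ Real.log (3 * X) := Real.log_le_log (by positivity) (by linarith)
      _ = Real.log 3 + Real.log X := Real.log_mul (by norm_num) hX0.ne'
      _ ≤ 2 * u * Lz := by rw [hlogXu]; linarith
  have hL₂0 : 0 ≤ Real.log (2 * X + h) := Real.log_nonneg (by linarith)
  -- `F = h/φ(h) ≥ 1`
  set F : ℝ := (h : ℝ) / Nat.totient h with hF
  have hφ0 : (0 : ℝ) < Nat.totient h := by exact_mod_cast Nat.totient_pos.mpr (by omega)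
  have hF1 : 1 ≤ F := by rw [hF, le_div_iff₀ hφ0, one_mul]; exact_mod_cast Nat.totient_le h
  have hF0 : 0 ≤ F := by linarith
  -- `P = V/η`, the exceptional-density currency, and its two bounds
  set P : ℝ := V / η with hP
  have hP0 : 0 ≤ P := by positivity
  have hvV : v ≤ V := by rw [hv]; exact div_le_self hV0.le hu1
  have hvη : v / η ≤ P := by rw [hP]; exact div_le_div_of_nonneg_right hvV hη0.le
  have hvη0 : 0 ≤ v / η := by positivity
  have hηpow : η ^ (-(1 / 4 : ℝ)) * η ^ (-(3 / 4 : ℝ)) = 1 / η := by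
    rw [← Real.rpow_add hη0, show (-(1 / 4 : ℝ)) + -(3 / 4 : ℝ) = -1 by norm_num, Real.rpow_neg_one, one_div]
  have hη34 : η ^ (-(3 / 4 : ℝ)) = Real.exp (-(3 * ℓ / 4)) := by
    rw [Real.rpow_def_of_pos hη0, ← hℓ]; ring_nf
  have hPeq : P = V * η ^ (-(1 / 4 : ℝ)) * Real.exp (-(3 * ℓ / 4)) := by
    rw [hP, ← hη34, mul_assoc, hηpow]; ring
  have hW : V * η ^ (-(1 / 4 : ℝ)) ≤ T := by
    rw [hT_def]; linarith [Real.exp_pos (-(C * Real.sqrt (V * ℓ)))]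
  have hW0 : 0 ≤ V * η ^ (-(1 / 4 : ℝ)) := by positivity
  obtain ⟨hc15, hc48⟩ := cube_mul_exp_bounds hℓ0
  have hu3ℓ : u ^ 3 ≤ ℓ ^ 3 := pow_le_pow_left₀ hu0.le huℓ 3
  have hPb1 : u ^ 3 * P ≤ 15 * T := by
    calc u ^ 3 * P ≤ ℓ ^ 3 * P := mul_le_mul_of_nonneg_right hu3ℓ hP0
      _ = (V * η ^ (-(1 / 4 : ℝ))) * (ℓ ^ 3 * Real.exp (-(3 * ℓ / 4))) := by rw [hPeq]; ring
      _ ≤ T * 15 := mul_le_mul hW hc15 (by positivity) hT0.le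
      _ = 15 * T := by ring
  have hPb2 : u ^ 3 * Real.exp ((7 / 10 : ℝ) * u) * P ≤ 48000 * T := by
    have h1 : u ^ 3 * Real.exp ((7 / 10 : ℝ) * u) ≤ ℓ ^ 3 * Real.exp ((7 / 10 : ℝ) * ℓ) :=
      mul_le_mul hu3ℓ (Real.exp_le_exp.mpr (by linarith)) (Real.exp_pos _).le (by positivity)
    calc u ^ 3 * Real.exp ((7 / 10 : ℝ) * u) * P ≤ ℓ ^ 3 * Real.exp ((7 / 10 : ℝ) * ℓ) * P :=
          mul_le_mul_of_nonneg_right h1 hP0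
      _ = (V * η ^ (-(1 / 4 : ℝ))) * (ℓ ^ 3 * Real.exp ((7 / 10 : ℝ) * ℓ) * Real.exp (-(3 * ℓ / 4))) := by
          rw [hPeq]; ring
      _ ≤ T * 48000 := mul_le_mul hW hc48 (by positivity) hT0.le
      _ = 48000 * T := by ring
  -- the normalisations of `…CnHalf`/`…CnTau`: `B ≤ 1`
  have hBv0 : 0 ≤ 1 / (v ^ 2 * η ^ (v / 2)) := by positivity
  have hBv' : 1 / (v ^ 2 * η ^ (v / 2)) ≤ (1 + u ^ 2) * Real.exp (-(50 * C ^ 2 * u)) := by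
    rw [hv]; exact hBv
  have hBsmall : 1 / (v ^ 2 * η ^ (v / 2)) ≤ 1 / 100 := by
    refine hBv'.trans ?_
    have h2u : 1 + u ^ 2 ≤ 2 * u ^ 2 := by
      have := one_le_pow₀ (M₀ := ℝ) hu1 (n := 2); linarith
    have h := pow_mul_exp_neg_mul_le 2 (show (0 : ℝ) < 50 * C ^ 2 by positivity) hu0.le
    have hf2 : ((2 : ℕ).factorial : ℝ) = 2 := by norm_num [Nat.factorial]
    rw [hf2] at h
    have h3 : (2 : ℝ) / (50 * C ^ 2) ^ 2 ≤ 1 / 200 := by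
      rw [div_le_div_iff₀ (by positivity) (by norm_num)]
      have hC4 : 1 ≤ (C ^ 2) ^ 2 := one_le_pow₀ hC2
      have e : 1 * (50 * C ^ 2) ^ 2 = 2500 * (C ^ 2) ^ 2 := by ring
      rw [e]; linarith
    calc (1 + u ^ 2) * Real.exp (-(50 * C ^ 2 * u)) ≤ 2 * u ^ 2 * Real.exp (-(50 * C ^ 2 * u)) :=
          mul_le_mul_of_nonneg_right h2u (Real.exp_pos _).le
      _ = 2 * (u ^ 2 * Real.exp (-(50 * C ^ 2 * u))) := by ring
      _ ≤ 2 * (1 / 200) := by linarith [h.trans h3]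
      _ = 1 / 100 := by norm_num
  have hPsmall : P * (u + 1) ≤ 1 / 5 := by
    -- `P (u+1) ≤ 2 ℓ V/η ≤ 2 ℓ η^{−3/4} = 2 ℓ e^{−3ℓ/4} ≤ 2 · 4/ℓ ≤ 8/44`
    obtain ⟨-, hsq4⟩ := sq_mul_exp_bounds hℓ0
    have hℓ1 : 1 ≤ ℓ := by linarith
    have h1 : P ≤ Real.exp (-(3 * ℓ / 4)) := by
      rw [hPeq]
      calc V * η ^ (-(1 / 4 : ℝ)) * Real.exp (-(3 * ℓ / 4)) ≤ 1 * Real.exp (-(3 * ℓ / 4)) :=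
            mul_le_mul_of_nonneg_right hnorm (Real.exp_pos _).le
        _ = Real.exp (-(3 * ℓ / 4)) := one_mul _
    have h2 : u + 1 ≤ 2 * ℓ := by linarith
    have h3 : ℓ * (ℓ * Real.exp (-(3 * ℓ / 4))) ≤ 4 := by
      have e : ℓ * (ℓ * Real.exp (-(3 * ℓ / 4))) = ℓ ^ 2 * Real.exp (-(3 * ℓ / 4)) := by ring
      rw [e]; exact hsq4
    have h4 : ℓ * Real.exp (-(3 * ℓ / 4)) ≤ 4 / 44 := by
      rw [le_div_iff₀ (by norm_num)]
      have h5 : 0 ≤ ℓ * Real.exp (-(3 * ℓ / 4)) := by positivity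
      calc ℓ * Real.exp (-(3 * ℓ / 4)) * 44 ≤ ℓ * Real.exp (-(3 * ℓ / 4)) * ℓ :=
            mul_le_mul_of_nonneg_left hℓ44' h5
        _ = ℓ * (ℓ * Real.exp (-(3 * ℓ / 4))) := by ring
        _ ≤ 4 := h3
    calc P * (u + 1) ≤ Real.exp (-(3 * ℓ / 4)) * (2 * ℓ) := mul_le_mul h1 h2 (by linarith) (Real.exp_pos _).le
      _ = 2 * (ℓ * Real.exp (-(3 * ℓ / 4))) := by ring
      _ ≤ 2 * (4 / 44) := by linarith
      _ ≤ 1 / 5 := by norm_num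
  have hratN : Real.log Nn / Real.log z ≤ u + 1 := by
    rw [hlogz, div_le_iff₀ hLz0]; linarith
  have hratM : Real.log ((Nn : ℝ) + h) / Real.log z ≤ u + 1 := by
    rw [hlogz, div_le_iff₀ hLz0]; linarith
  have hratN0 : 0 ≤ Real.log Nn / Real.log z := by rw [hlogz]; positivity
  have hratM0 : 0 ≤ Real.log ((Nn : ℝ) + h) / Real.log z := by rw [hlogz]; positivity
  have hzinv : 1 / z ≤ 1 / 100 := by
    rw [div_le_div_iff₀ hz0 (by norm_num)]; linarith
  have hnorm1 : 1 / (v ^ 2 * η ^ (v / 2)) + v / η * (Real.log Nn / Real.log z) + 1 / z ≤ 1 := by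
    have h1 : v / η * (Real.log Nn / Real.log z) ≤ P * (u + 1) := mul_le_mul hvη hratN hratN0 hP0
    linarith
  have hnorm2 : 1 / (v ^ 2 * η ^ (v / 2)) + v / η * (Real.log ((Nn : ℝ) + h) / Real.log z) ≤ 1 := by
    have h1 : v / η * (Real.log ((Nn : ℝ) + h) / Real.log z) ≤ P * (u + 1) := mul_le_mul hvη hratM hratM0 hP0
    linarith
  have hratz : Real.log Nn / Real.log z ≤ z - 1 := by
    have : u + 1 ≤ z - 1 := by linarith
    linarith
  -- the three inputs
  have h26 := MatomakiMerikoski2023_eq26 χ hquad hX1.le h z (q := q) (NeZero.ne q) g hg0 hg1 hgs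
  have hC1 := H₁ q χ hprim hquad η hη10 hL v hv0 Nn h hh hz2 hzN hratz hnorm1
  have hC2' := H₂ q χ hprim hquad η hη₂ hL v hv0 Nn h hh hz4 hzN.le hnorm2
  rw [hlogz] at hC1 hC2'
  -- the bookkeeping lemmas
  have hE1 := eq71_E1_le (K₁ := K₁) (F := F) (Nn := (Nn : ℝ)) (lN := Real.log Nn)
    (L₂ := Real.log (2 * X + h)) (Bv := 1 / (v ^ 2 * η ^ (v / 2))) (vη := v / η) (P := P)
    hC hu2 hLz hX0 hzexp hT hK₁.le hF0 hN2X hlogN0 hlogN hL₂0 hL₂ hBv0 hBv' hvη0 hvη hPb1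
  have hE2a := eq71_E2a_le (K₂ := K₂) (F := F) (M := (Nn : ℝ) + h) (lM := Real.log ((Nn : ℝ) + h))
    (lN := Real.log Nn) (L₂ := Real.log (2 * X + h)) (Bv := 1 / (v ^ 2 * η ^ (v / 2))) (vη := v / η) (P := P)
    hC hu2 hLz hX0 hzexp hT hK₂.le hF0 hM0 hM3 hlogM0 hlogM hlogN0 hlogN hL₂0 hL₂ hBv0 hBv' hvη0 hvη hPb2
  have hE2b := eq71_E2b_le (K₂ := K₂) (M := (Nn : ℝ) + h) (lM := Real.log ((Nn : ℝ) + h))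
    (L₂ := Real.log (2 * X + h)) hC hu2 hLz hXexp hzexp hT hK₂.le hM0 hM3 hlogM0 hlogM hL₂0 hL₂
  -- (E0): the counts
  have hcz : (((Nat.primesBelow ⌈z⌉₊).card : ℕ) : ℝ) ≤ z + 1 := by
    have h1 : (Nat.primesBelow ⌈z⌉₊).card ≤ ⌈z⌉₊ := by
      calc (Nat.primesBelow ⌈z⌉₊).card ≤ (Finset.range ⌈z⌉₊).card := Finset.card_le_card (Finset.filter_subset _ _)
        _ = ⌈z⌉₊ := Finset.card_range _
    calc (((Nat.primesBelow ⌈z⌉₊).card : ℕ) : ℝ) ≤ ⌈z⌉₊ := by exact_mod_cast h1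
      _ ≤ z + 1 := (Nat.ceil_lt_add_one hz0.le).le
  have hcq : ((q.primeFactors.card : ℕ) : ℝ) ≤ 2 * u * Lz := by
    have h1 := card_primeFactors_le_log_div' (NeZero.ne q) one_lt_two
      (fun p hp => by exact_mod_cast (Nat.prime_of_mem_primeFactors hp).two_le)
    have hl2 := Real.log_two_gt_d9
    have h2 : Real.log q / Real.log 2 ≤ 2 * Real.log q := by
      rw [div_le_iff₀ (by linarith)]
      have h22 : (1 : ℝ) ≤ 2 * Real.log 2 := by linarith
      calc Real.log q = Real.log q * 1 := by ring
        _ ≤ Real.log q * (2 * Real.log 2) := mul_le_mul_of_nonneg_left h22 hlogq.le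
        _ = 2 * Real.log q * Real.log 2 := by ring
    have h3 : Real.log q ≤ Real.log X := by
      rw [hlogXeq]; exact le_mul_of_one_le_left hlogq.le hV1
    calc ((q.primeFactors.card : ℕ) : ℝ) ≤ Real.log q / Real.log 2 := h1
      _ ≤ 2 * Real.log q := h2
      _ ≤ 2 * Real.log X := by linarith
      _ = 2 * u * Lz := by rw [hlogXu]; ring
  have hE0 := eq71_E0_le (cz := (((Nat.primesBelow ⌈z⌉₊).card : ℕ) : ℝ)) (cq := ((q.primeFactors.card : ℕ) : ℝ))
    (L₂ := Real.log (2 * X + h)) hC hu2 hLz hXexp hzexp hT hcz hcq hL₂0 hL₂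
  -- assemble
  set Adm := (Icc 1 Nn).filter (fun n : ℕ =>
      (∀ p ∈ n.primeFactors, z ≤ (p : ℝ) ∧ ¬ p ∣ q) ∧ (∀ p ∈ (n + h).primeFactors, z ≤ (p : ℝ) ∧ ¬ p ∣ q))
    with hAdm
  have hsplit : ∑ n ∈ Adm, ((n.divisors.card : ℝ) * (charLog χ (n + h) - Λ (n + h)) + (charLog χ n - Λ n)) =
      (∑ n ∈ Adm, (n.divisors.card : ℝ) * (charLog χ (n + h) - Λ (n + h))) +
        ∑ n ∈ Adm, (charLog χ n - Λ n) := Finset.sum_add_distrib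
  have hmain : Real.log (2 * X + h) *
      ∑ n ∈ Adm, ((n.divisors.card : ℝ) * (charLog χ (n + h) - Λ (n + h)) + (charLog χ n - Λ n)) ≤
      10 ^ 8 * K₂ * F * X * T + 4608 * K₂ * X * T + 1400 * K₁ * F * X * T := by
    rw [hsplit, mul_add]
    refine add_le_add ?_ ?_
    · calc Real.log (2 * X + h) * ∑ n ∈ Adm, (n.divisors.card : ℝ) * (charLog χ (n + h) - Λ (n + h))
          ≤ Real.log (2 * X + h) * _ := mul_le_mul_of_nonneg_left hC2' hL₂0
        _ ≤ 10 ^ 8 * K₂ * F * X * T + 4608 * K₂ * X * T := by rw [mul_add]; exact add_le_add hE2a hE2b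
    · calc Real.log (2 * X + h) * ∑ n ∈ Adm, (charLog χ n - Λ n)
          ≤ Real.log (2 * X + h) * _ := mul_le_mul_of_nonneg_left hC1 hL₂0
        _ ≤ 1400 * K₁ * F * X * T := hE1
  have hXT : 0 ≤ X * T := by positivity
  calc _ ≤ _ := h26
    _ ≤ 2500 * X * T + (10 ^ 8 * K₂ * F * X * T + 4608 * K₂ * X * T + 1400 * K₁ * F * X * T) := by
        exact add_le_add hE0 hmain
    _ ≤ (2500 + 1400 * K₁ + 10 ^ 8 * K₂ + 4608 * K₂) * F * X * T := by
        have h1 : 2500 * X * T ≤ 2500 * F * X * T := by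
          have := mul_le_mul_of_nonneg_left hF1 (show (0:ℝ) ≤ 2500 * (X * T) by positivity)
          linarith
        have h2 : 4608 * K₂ * X * T ≤ 4608 * K₂ * F * X * T := by
          have := mul_le_mul_of_nonneg_left hF1 (show (0:ℝ) ≤ 4608 * K₂ * (X * T) by positivity)
          linarith
        linarith
    _ = _ := by rw [hF, hT_def]

end Literature.Barriers.Parity.MatomakiMerikoski

end
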